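import Summits.NavierStokesRegularity.NavierStokesRegularity.Theorems.WakeRatchetEternalViscousRateCircuitPumpFixedSeedBlockDSS
import Summits.NavierStokesRegularity.NavierStokesRegularity.Theorems.TaoLadderRungTwoBreakNoLoudLadderOne.Negative.NoLoudLadderOneFalseOfViscousBlockDSSWaves
import HarnessLib
import HarnessLib.Audit

/-!
# `TaoLadderRungTwoBreak.NoSurvivingEternalViscBddOne` (stmt-NavierStokesRegularity-20419, K1ᵛ) and `NoLoudLadderOne`
# (stmt-NavierStokesRegularity-20452) — negative lemmas modulo FINE-SCALE TODA PUMPS AT A FIXED SEED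

The K1ᵛ family of route `TaoLadderRungTwoBreak` is refuted modulo the ABSTRACT construction item
`WakeRatchetViscDSS.ViscousBlockDSSWaves` (tree: `…NoLoudLadderOne/Negative/NoLoudLadderOneFalseOfViscousBlockDSSWaves`,
`NoSurvivingEternalViscBddOne_false_of_ViscousBlockDSSWaves`, `NoLoudLadderOne_false_of_ViscousBlockDSSWaves`).  The EXPLICIT item
`WakeRatchetCircuitPumpNoUniform.FineFixedSeedTodaPumps` (p829025: exactly self-similar Type-I non-trivial solutions of the m = 2
seeded graded Toda circuit `T_ε` at ONE fixed seed and arbitrarily fine scale ratios — the fixed-seed continuation `lam ↓ 1` of the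
PROVED perpetual pump, stmt-1834) implies the abstract one (`viscousBlockDSSWaves_of_fineFixedSeedTodaPumps`, p829160).  Hence:

* `NoSurvivingEternalViscBddOne_false_of_FineFixedSeedTodaPumps : FineFixedSeedTodaPumps → ¬ NoSurvivingEternalViscBddOne`;
* `NoLoudLadderOne_false_of_FineFixedSeedTodaPumps : FineFixedSeedTodaPumps → ¬ NoLoudLadderOne`.

So ONE concrete two-mode ODE continuation problem would refute ⟨20419⟩, ⟨20452⟩, ⟨25647⟩, ⟨25584⟩ at once.  OPEN (see
`…/Negative/EternalViscousRateFalseOfFineFixedSeedTodaPumps` for why it is not constructed); no verdict changes.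
HONEST FRAMING: MODEL lattice ODEs only (Tao 2016 §4, §6.4); nothing here is a statement about the Navier–Stokes equations; no
summit statement is proved or refuted.
-/

noncomputable section

set_option linter.dupNamespace false

namespace Summit.NavierStokesRegularity.NavierStokesRegularity.Theorems

namespace WakeRatchetCircuitPumpNoUniform

open Summit.NavierStokesRegularity.NavierStokesRegularity.Cruxes.EternalViscousRate.DissipationEdge

/-- **Negative lemma: `FineFixedSeedTodaPumps → ¬ NoSurvivingEternalViscBddOne`** (⟨20419⟩, K1ᵛ of `TaoLadderRungTwoBreak`),
via `viscousBlockDSSWaves_of_fineFixedSeedTodaPumps` and the landed kill modulo `ViscousBlockDSSWaves`.  MODEL lattice only.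
[cite: Tao2016AveragedNS, §4 Thm. 4.2 (statement shape), the viscous equation before it, §6.4; cell vocabulary (stmt-NavierStokesRegularity-20419)] -/
theorem NoSurvivingEternalViscBddOne_false_of_FineFixedSeedTodaPumps :
    FineFixedSeedTodaPumps →
      ¬ Summit.NavierStokesRegularity.NavierStokesRegularity.Theses.TaoLadderRungTwoBreak.NoSurvivingEternalViscBddOne :=
  fun h => NoSurvivingEternalViscBddOne_false_of_ViscousBlockDSSWaves (viscousBlockDSSWaves_of_fineFixedSeedTodaPumps h)

/-- **Negative lemma: `FineFixedSeedTodaPumps → ¬ NoLoudLadderOne`** (⟨20452⟩, the loud-ladder exclusion of `TaoLadderRungTwoBreak`).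
MODEL lattice only.
[cite: Tao2016AveragedNS, §4 Thm. 4.2 (statement shape), the viscous equation before it, §6.4; cell vocabulary (stmt-NavierStokesRegularity-20452)] -/
theorem NoLoudLadderOne_false_of_FineFixedSeedTodaPumps :
    FineFixedSeedTodaPumps →
      ¬ Summit.NavierStokesRegularity.NavierStokesRegularity.Theses.TaoLadderRungTwoBreak.NoLoudLadderOne :=
  fun h => NoLoudLadderOne_false_of_ViscousBlockDSSWaves (viscousBlockDSSWaves_of_fineFixedSeedTodaPumps h)

end WakeRatchetCircuitPumpNoUniform

end Summit.NavierStokesRegularity.NavierStokesRegularity.Theorems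

end
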